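import Summits.QuantumFields.YangMills.Theses.ThermalDescent

/-!
# BC3 birth skeleton — crux `PeriodDescent` (stmt-QuantumFields-26517) of route `ThermalDescent` (rev 2)

Line «short-centred period descent» (ideator ym-idea-6 g3, 2026-08-28).  Three registered stubs and the
kernel-checked composition `PeriodDescent_of : PeriodDescent` (uses exactly `stub_hsTransfer`, `stub_centring` (twice), `stub_spectral`):

* `stub_hsTransfer` (L, load-bearing) — the Hilbert–Schmidt transfer inequality for the slab observable centred at the
  SHORT period: `Z(S,T')·E_T'[(θB − ⟨B⟩_T)(B − ⟨B⟩_T)] ≤ λ₀(S)^(T'−T)·Z(S,T)·E_T[(θB − ⟨B⟩_T)(B − ⟨B⟩_T)]`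
  (`T ≤ T'`, `β ≥ 0` so `𝕋 ≥ 0`; `Tr(X𝕋^m) ≤ λ₀^m·Tr X` for `X = (𝕋^(b/2)𝔽†𝕋^(a/2))(…)† ≥ 0`; slab fits in the half period).
* `stub_centring` (M) — reflection invariance of the torus state + bilinearity:
  `E_P'[(θB − ⟨B⟩_P)(B − ⟨B⟩_P)] = Cov_P'(θB, B) + (⟨B⟩_P' − ⟨B⟩_P)²` (no hypotheses: `E_P'[θB] = E_P'[B]`, `E[1] = 1`).
* `stub_spectral` (S/M) — from the tree's trace formula `exists_spectralData_wilsonFinTorusPartition`: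
  `0 < λ₀`, `λ₀^T' ≤ Z(S,T')`, `Z(S,2T) ≤ λ₀^T·Z(S,T)` for `2 ≤ T ≤ T'`, `β ≥ 0`.

The composition discards the squared shift (≥ 0) on the long side and chains `Z(S,2T)/Z(S,T)² ≤ λ₀^T/Z(S,T) ≤
Z(S,T')/(λ₀^(T'−T)·Z(S,T))` — pure real algebra (`algebra_core`).  Sorries ONLY inside `stub_*`.
-/

set_option autoImplicit false
set_option maxHeartbeats 800000
set_option linter.unusedVariables false

namespace Summit.QuantumFields.YangMills.Cruxes.PeriodDescent.Birth

open MeasureTheory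

/-- **stub_hsTransfer** (L, load-bearing): the short-centred Hilbert–Schmidt transfer inequality. -/
theorem stub_hsTransfer :
    ∀ (G : Type) [Group G] [TopologicalSpace G] [IsTopologicalGroup G] [CompactSpace G], Literature.MathematicalPhysics.QuantumFieldTheory.IsCompactSimpleLieGroup G → letI : MeasurableSpace G := borel G; haveI : BorelSpace G := ⟨rfl⟩; ∀ (r : Literature.MathematicalPhysics.QuantumFieldTheory.LatticeRep G), let St : ℕ → ℕ → Type := fun S T => Literature.MathematicalPhysics.QuantumFieldTheory.FinTorusSite S S S T; let Cfg : ℕ → ℕ → Type := fun S T => Literature.MathematicalPhysics.QuantumFieldTheory.FinTorusSite S S S T × Fin 4 → G; let cc : (n : ℕ) → Fin n → ℤ := fun n i => if 2 * i.val < n then (i.val : ℤ) else (i.val : ℤ) - n; let posE : (S T : ℕ) → St S T → EuclideanSpace ℝ (Fin 4) := fun S T x => Literature.MathematicalPhysics.QuantumLattice.siteToE (d := 4) ![cc T x.2.2.2, cc S x.1, cc S x.2.1, cc S x.2.2.1]; let P : (S T : ℕ) → St S T → Fin 4 → Fin 4 → Cfg S T → ℝ := fun _ _ x i j U => (r.ρ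 (Literature.MathematicalPhysics.QuantumFieldTheory.finTorusPlaquette U x i j)).trace.re; let A : (S T : ℕ) → St S T → Cfg S T → ℝ := fun S T x U => ∑ q : {q : Fin 4 × Fin 4 // q.1 < q.2}, P S T x q.1.1 q.1.2 U; let w : ℝ → (S T : ℕ) → Cfg S T → ℝ := fun β S T U => Real.exp (-β * ∑ x : St S T, ∑ q : {q : Fin 4 × Fin 4 // q.1 < q.2}, ((r.N : ℝ) - P S T x q.1.1 q.1.2 U)); let E : ℝ → (S T : ℕ) → (Cfg S T → ℝ) → ℝ := fun β S T F => (∫ U : Literature.MathematicalPhysics.QuantumFieldTheory.FinTorusSite S S S T × Fin 4 → G, F U * w β S T U ∂MeasureTheory.Measure.pi (fun _ => Literature.MathematicalPhysics.QuantumFieldTheory.haarProbability G)) / Literature.MathematicalPhysics.QuantumFieldTheory.wilsonFinTorusPartition r.ρ β S S S T; let Cov : ℝ → (S T : ℕ) → (Cfg S T → ℝ) → (Cfg S T → ℝ) → ℝ := fun β S T F F' => E β S T (fun U => F U * F' U) - E β S T F * E β S T F'; let refl : (S T : ℕ) → Cfg S T → Cfg S T := fun _ T U e => if e.2 = Fin.last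 3 then (U ((e.1.1, e.1.2.1, e.1.2.2.1, Fin.rev e.1.2.2.2), Fin.last 3))⁻¹ else U ((e.1.1, e.1.2.1, e.1.2.2.1, ⟨(T - e.1.2.2.2.val) % T, Nat.mod_lt _ e.1.2.2.2.pos⟩), e.2); let B : (S T : ℕ) → ℝ → SchwartzMap (EuclideanSpace ℝ (Fin 4)) ℝ → Cfg S T → ℝ := fun S T s f U => ∑ x : St S T, f (s • posE S T x) * A S T x U; let Qrp : ℝ → (S T : ℕ) → ℝ → SchwartzMap (EuclideanSpace ℝ (Fin 4)) ℝ → ℝ := fun β S T s f => Cov β S T (fun U => B S T s f (refl S T U)) (B S T s f); let pur : ℝ → (S T : ℕ) → ℝ := fun β S T => Literature.MathematicalPhysics.QuantumFieldTheory.wilsonFinTorusPartition r.ρ β S S S (2 * T) / Literature.MathematicalPhysics.QuantumFieldTheory.wilsonFinTorusPartition r.ρ β S S S T ^ 2; ∀ (β : ℝ) (S : ℕ) [NeZero S] (T T' : ℕ) (s : ℝ) (v : SchwartzMap (EuclideanSpace ℝ (Fin 4)) ℝ) (δ₁ δ₂ : ℝ), 0 ≤ β → 2 ≤ T → T ≤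 T' → 0 < s → 0 < δ₁ → tsupport v ⊆ {y : EuclideanSpace ℝ (Fin 4) | δ₁ < y 0 ∧ y 0 < δ₂} → 2 * δ₂ + 2 * s ≤ s * T → Literature.MathematicalPhysics.QuantumFieldTheory.wilsonFinTorusPartition r.ρ β S S S T' * E β S T' (fun U => (B S T' s v (refl S T' U) - E β S T (B S T s v)) * (B S T' s v U - E β S T (B S T s v))) ≤ Literature.MathematicalPhysics.QuantumFieldTheory.transferSpectralRadius r.ρ β S ^ (T' - T) * Literature.MathematicalPhysics.QuantumFieldTheory.wilsonFinTorusPartition r.ρ β S S S T * E β S T (fun U => (B S T s v (refl S T U) - E β S T (B S T s v)) * (B S T s v U - E β S T (B S T s v))) := by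
  sorry

/-- **stub_centring** (M): reflection invariance + bilinearity of the normalised torus expectation. -/
theorem stub_centring :
    ∀ (G : Type) [Group G] [TopologicalSpace G] [IsTopologicalGroup G] [CompactSpace G], Literature.MathematicalPhysics.QuantumFieldTheory.IsCompactSimpleLieGroup G → letI : MeasurableSpace G := borel G; haveI : BorelSpace G := ⟨rfl⟩; ∀ (r : Literature.MathematicalPhysics.QuantumFieldTheory.LatticeRep G), let St : ℕ → ℕ → Type := fun S T => Literature.MathematicalPhysics.QuantumFieldTheory.FinTorusSite S S S T; let Cfg : ℕ → ℕ → Type := fun S T => Literature.MathematicalPhysics.QuantumFieldTheory.FinTorusSite S S S T × Fin 4 → G; let cc : (n : ℕ) → Fin n → ℤ := fun n i => if 2 * i.val < n then (i.val : ℤ) else (i.val : ℤ) - n; let posE : (S T : ℕ) → St S T → EuclideanSpace ℝ (Fin 4) := fun S T x => Literature.MathematicalPhysics.QuantumLattice.siteToE (d := 4) ![cc T x.2.2.2, cc S x.1, cc S x.2.1, cc S x.2.2.1]; let P : (S T : ℕ) → St S T → Fin 4 → Fin 4 → Cfg S T → ℝ := fun _ _ x i j U => (r.ρ (Literature.MathematicalPhysics.QuantumFieldTheory.finTorusPlaquette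 U x i j)).trace.re; let A : (S T : ℕ) → St S T → Cfg S T → ℝ := fun S T x U => ∑ q : {q : Fin 4 × Fin 4 // q.1 < q.2}, P S T x q.1.1 q.1.2 U; let w : ℝ → (S T : ℕ) → Cfg S T → ℝ := fun β S T U => Real.exp (-β * ∑ x : St S T, ∑ q : {q : Fin 4 × Fin 4 // q.1 < q.2}, ((r.N : ℝ) - P S T x q.1.1 q.1.2 U)); let E : ℝ → (S T : ℕ) → (Cfg S T → ℝ) → ℝ := fun β S T F => (∫ U : Literature.MathematicalPhysics.QuantumFieldTheory.FinTorusSite S S S T × Fin 4 → G, F U * w β S T U ∂MeasureTheory.Measure.pi (fun _ => Literature.MathematicalPhysics.QuantumFieldTheory.haarProbability G)) / Literature.MathematicalPhysics.QuantumFieldTheory.wilsonFinTorusPartition r.ρ β S S S T; let Cov : ℝ → (S T : ℕ) → (Cfg S T → ℝ) → (Cfg S T → ℝ) → ℝ := fun β S T F F' => E β S T (fun U => F U * F' U) - E β S T F * E β S T F'; let refl : (S T : ℕ) → Cfg S T → Cfg S T := fun _ T U e => if e.2 = Fin.last 3 then (U ((e.1.1, e.1.2.1, e.1.2.2.1, Fin.rev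 e.1.2.2.2), Fin.last 3))⁻¹ else U ((e.1.1, e.1.2.1, e.1.2.2.1, ⟨(T - e.1.2.2.2.val) % T, Nat.mod_lt _ e.1.2.2.2.pos⟩), e.2); let B : (S T : ℕ) → ℝ → SchwartzMap (EuclideanSpace ℝ (Fin 4)) ℝ → Cfg S T → ℝ := fun S T s f U => ∑ x : St S T, f (s • posE S T x) * A S T x U; let Qrp : ℝ → (S T : ℕ) → ℝ → SchwartzMap (EuclideanSpace ℝ (Fin 4)) ℝ → ℝ := fun β S T s f => Cov β S T (fun U => B S T s f (refl S T U)) (B S T s f); let pur : ℝ → (S T : ℕ) → ℝ := fun β S T => Literature.MathematicalPhysics.QuantumFieldTheory.wilsonFinTorusPartition r.ρ β S S S (2 * T) / Literature.MathematicalPhysics.QuantumFieldTheory.wilsonFinTorusPartition r.ρ β S S S T ^ 2; ∀ (β : ℝ) (S P P' : ℕ) (s : ℝ) (v : SchwartzMap (EuclideanSpace ℝ (Fin 4)) ℝ), E β S P' (fun U => (B S P' s v (refl S P' U) - E β S P (B S P s v)) * (B S P' s v U - E β S P (B S P s v))) = Qrp β S P' s v + (E β S P' (B S P' s v) - E β S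 P (B S P s v)) ^ 2 := by
  sorry

/-- **stub_spectral** (S/M): top-eigenvalue bounds from the trace formula `Z(S,m+2) = Σλᵢ^(m+2)`. -/
theorem stub_spectral :
    ∀ (G : Type) [Group G] [TopologicalSpace G] [IsTopologicalGroup G] [CompactSpace G], Literature.MathematicalPhysics.QuantumFieldTheory.IsCompactSimpleLieGroup G → letI : MeasurableSpace G := borel G; haveI : BorelSpace G := ⟨rfl⟩; ∀ (r : Literature.MathematicalPhysics.QuantumFieldTheory.LatticeRep G) (β : ℝ) (S : ℕ) [NeZero S] (T T' : ℕ), 0 ≤ β → 2 ≤ T → T ≤ T' → 0 < Literature.MathematicalPhysics.QuantumFieldTheory.transferSpectralRadius r.ρ β S ∧ Literature.MathematicalPhysics.QuantumFieldTheory.transferSpectralRadius r.ρ β S ^ T' ≤ Literature.MathematicalPhysics.QuantumFieldTheory.wilsonFinTorusPartition r.ρ β S S S T' ∧ Literature.MathematicalPhysics.QuantumFieldTheory.wilsonFinTorusPartition r.ρ β S S S (2 * T) ≤ Literature.MathematicalPhysics.QuantumFieldTheory.transferSpectralRadius r.ρ β S ^ T * Literature.MathematicalPhysics.QuantumFieldTheory.wilsonFinTorusPartition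 r.ρ β S S S T := by
  sorry

/-- The real-number core of the descent: discard the squared shift, then chain the eigenvalue bounds. -/
theorem algebra_core {Zp Z1 Z2 lam e e' q q' x sh : ℝ} {m T : ℕ} (hlam : 0 < lam) (hZ1 : 0 < Z1)
    (hZp : 0 < Zp) (h1 : Zp * e' ≤ lam ^ m * Z1 * e) (h2 : e = q + (x - x) ^ 2) (h3 : e' = q' + sh)
    (hsh : 0 ≤ sh) (hq' : 0 ≤ q') (h4 : lam ^ (T + m) ≤ Zp) (h5 : Z2 ≤ lam ^ T * Z1) :
    Z2 / Z1 ^ 2 * q' ≤ q := by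
  have hm : 0 < lam ^ m := pow_pos hlam m
  have he : e = q := by rw [h2, sub_self]; ring
  rw [he, h3] at h1
  have hA : Zp * q' ≤ lam ^ m * Z1 * q := by nlinarith [mul_nonneg hZp.le hsh]
  have hD : lam ^ T * q' ≤ Z1 * q := by
    have h' : lam ^ m * (lam ^ T * q') ≤ lam ^ m * (Z1 * q) := by
      calc lam ^ m * (lam ^ T * q') = lam ^ (T + m) * q' := by rw [pow_add]; ring
        _ ≤ Zp * q' := mul_le_mul_of_nonneg_right h4 hq'
        _ ≤ lam ^ m * Z1 * q := hA
        _ = lam ^ m * (Z1 * q) := by ring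
    exact le_of_mul_le_mul_left h' hm
  have hE : Z2 * q' ≤ q * Z1 ^ 2 := by
    calc Z2 * q' ≤ lam ^ T * Z1 * q' := mul_le_mul_of_nonneg_right h5 hq'
      _ = Z1 * (lam ^ T * q') := by ring
      _ ≤ Z1 * (Z1 * q) := mul_le_mul_of_nonneg_left hD hZ1.le
      _ = q * Z1 ^ 2 := by ring
  have hZ1sq : 0 < Z1 ^ 2 := by positivity
  rw [div_mul_eq_mul_div, div_le_iff₀ hZ1sq]
  exact hE

/-- **Composition (kernel-checked): the three stubs imply the crux `PeriodDescent` BY NAME.** -/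
theorem PeriodDescent_of :
    Summit.QuantumFields.YangMills.Theses.ThermalDescent.PeriodDescent := by
  intro G _ _ _ _ hG r
  dsimp only
  intro β L k s v δ₁ δ₂ hβ hL hs hδ₁ hsupp hsz hq
  letI : MeasurableSpace G := borel G
  haveI : BorelSpace G := ⟨rfl⟩
  haveI : SecondCountableTopology G :=
    (r.continuous.isClosedEmbedding r.injective).isEmbedding.secondCountableTopology
  have hT2 : 2 ≤ 2 * L + 1 := by omega
  have hTT' : 2 * L + 1 ≤ 2 ^ k * (2 * L + 1) := Nat.le_mul_of_pos_left _ (Nat.two_pow_pos k)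
  have hslab : 2 * δ₂ + 2 * s ≤ s * ((2 * L + 1 : ℕ) : ℝ) := by
    push_cast
    nlinarith
  have h1 := stub_hsTransfer G hG r β (2 * L + 1) (2 * L + 1) (2 ^ k * (2 * L + 1)) s v δ₁ δ₂ hβ hT2 hTT' hs hδ₁ hsupp hslab
  have h2 := stub_centring G hG r β (2 * L + 1) (2 * L + 1) (2 * L + 1) s v
  have h3 := stub_centring G hG r β (2 * L + 1) (2 * L + 1) (2 ^ k * (2 * L + 1)) s v
  obtain ⟨hlam, h4, h5⟩ := stub_spectral G hG r β (2 * L + 1) (2 * L + 1) (2 ^ k * (2 * L + 1)) hβ hT2 hTT'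
  have hZ1 := Literature.MathematicalPhysics.QuantumFieldTheory.wilsonFinTorusPartition_pos (ρ := r.ρ)
    r.continuous β (2 * L + 1) (2 * L + 1) (2 * L + 1) (2 * L + 1)
  have hZp := Literature.MathematicalPhysics.QuantumFieldTheory.wilsonFinTorusPartition_pos (ρ := r.ρ)
    r.continuous β (2 * L + 1) (2 * L + 1) (2 * L + 1) (2 ^ k * (2 * L + 1))
  have h4' : Literature.MathematicalPhysics.QuantumFieldTheory.transferSpectralRadius r.ρ β (2 * L + 1) ^
      (2 * L + 1 + (2 ^ k * (2 * L + 1) - (2 * L + 1))) ≤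
      Literature.MathematicalPhysics.QuantumFieldTheory.wilsonFinTorusPartition r.ρ β (2 * L + 1) (2 * L + 1)
        (2 * L + 1) (2 ^ k * (2 * L + 1)) := by
    rw [Nat.add_sub_of_le hTT']; exact h4
  exact algebra_core hlam hZ1 hZp h1 h2 h3 (sq_nonneg _) hq h4' h5

end Summit.QuantumFields.YangMills.Cruxes.PeriodDescent.Birth
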